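import Literature.Computability.Complexity.RandomOraclePHProofs
import Literature.Computability.Complexity.AverageCaseDepthHierarchyThm1
import HarnessLib

/-!
# `PH` is infinite relative to a random oracle: Rossman–Servedio–Tan 2015, Thm. 2, proved

B. Rossman, R. A. Servedio, L.-Y. Tan, *An average-case depth hierarchy theorem for Boolean
circuits*, FOCS 2015, arXiv:1504.03398 [RossmanServedioTan2015], **Theorem 2** (p. 3; §2.3
p. 7): "The polynomial hierarchy is infinite relative to a random oracle: with probability `1`, a
random oracle `A` satisfies `Σ_d^{P,A} ⊊ Σ_{d+1}^{P,A}` for all `d ∈ ℕ`."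

This file discharges the tree's named fact `rossmanServedioTan2015_thm2` (`RandomOraclePH.lean`):
`rossmanServedioTan2015_thm2_holds` is the derivation "Thm. 2 from Thm. 1"
(`rossmanServedioTan2015_thm2_of_inRegime`, `RandomOraclePHProofs.lean`: the Furst–Saxe–Sipser /
Sipser / Håstad Ch. 7 connection — diagonal Sipser languages in `PH^A`
(`RandomOraclePHSipser*.lean`), `Σₖ^A` predicates as depth-`(k+2)` window circuits, RST's
parameters for fixed depth (`RandomOraclePHAsymptotics.lean`), and the measure-one bookkeeping
over sparse input lengths (`QuantumComplexity/RandomOracleIndependence.lean`)) applied to the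
tree's proof `rossmanServedioTan2015_thm1_inRegime_holds` (`AverageCaseDepthHierarchyThm1.lean`
and its `AverageCaseDepthHierarchy*` siblings: RST §7–§11, the random projections, the projection
switching lemma, typicality and the error budget) of the average-case depth hierarchy theorem,
Thm. 1 in the regime `d ≤ c m / log₂ m` of Lemma 7.1. The two standard readings follow in closed
form: almost surely `PH^A` is infinite in the sense `∀ k, Σₖ^A ≠ Σₖ₊₁^A` (`IsInfinitePHRel`, the
form used by Aaronson–Chen 2017, §5), and Meyer's question has an affirmative answer (some oracle
separates all consecutive levels; Håstad 1986 for the worst case, §2.2 p. 6).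

## Sources

* [RossmanServedioTan2015] arXiv:1504.03398: Thm. 1 and Thm. 2 (p. 3), §2.2 (p. 6), §2.3 (p. 7:
  Thm. 2 restated; "we refer the reader to Chapter 7 of Håstad's thesis for the proof of how
  Theorem 2 follows from Theorem 1").
-/

noncomputable section

namespace Literature.Computability.Complexity

open _root_.MeasureTheory _root_.Computability Literature.Computability.QuantumComplexity
  Literature.Barriers.QuantumAdvantage

/-- **Rossman–Servedio–Tan 2015, Thm. 2, proved: the polynomial hierarchy is infinite relative to
a random oracle** — "with probability `1`, a random oracle `A` satisfies `Σ_d^{P,A} ⊊ Σ_{d+1}^{P,A}`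
for all `d ∈ ℕ`"; the discharge of the named fact `rossmanServedioTan2015_thm2`: the derivation
`rossmanServedioTan2015_thm2_of_inRegime` (Thm. 2 from Thm. 1 in the regime of Lemma 7.1) applied
to the tree's proof `rossmanServedioTan2015_thm1_inRegime_holds` of Thm. 1.
[cite: RossmanServedioTan2015, Thm. 2 (arXiv:1504.03398 p. 3; §2.3 p. 7)] -/
theorem rossmanServedioTan2015_thm2_holds : rossmanServedioTan2015_thm2 :=
  rossmanServedioTan2015_thm2_of_inRegime rossmanServedioTan2015_thm1_inRegime_holds

/-- **Almost surely `PH^A` is infinite**: for almost every oracle `A`, no two consecutive levels of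
the relativized polynomial hierarchy coincide (`IsInfinitePHRel O` is `∀ k, Σₖ^O ≠ Σₖ₊₁^O`; closed
form of `rossmanServedioTan2015_thm2.ae_ne`). [cite: RossmanServedioTan2015, Thm. 2 (p. 3)] -/
theorem ae_isInfinitePHRel_randomOracle :
    ∀ᵐ (A : Set (List Bool)) ∂randomOracleMeasure, IsInfinitePHRel (Oracle.ofLanguage A) :=
  rossmanServedioTan2015_thm2.ae_ne rossmanServedioTan2015_thm2_holds

/-- **Meyer's question, affirmatively** (closed form of `rossmanServedioTan2015_thm2.exists_oracle`;
Håstad 1986 for the worst case, here read off the probability-one statement): some oracle `A` has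
`Σ_d^{P,A} ⊊ Σ_{d+1}^{P,A}` for every `d`. [cite: RossmanServedioTan2015, §2.2 (p. 6) and Thm. 2 (p. 3)] -/
theorem exists_oracle_sigmaPRel_ssubset_succ :
    ∃ A : Language Bool, ∀ d : ℕ,
      SigmaPRel (Oracle.ofLanguage A) d ⊂ SigmaPRel (Oracle.ofLanguage A) (d + 1) :=
  rossmanServedioTan2015_thm2.exists_oracle rossmanServedioTan2015_thm2_holds

end Literature.Computability.Complexity

end
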